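import Summits.CriticalPhenomena.CardyFormulaZ2.Theorems.CardyComplexConeEdgePrecompactUFRSMixedSectors

/-!
# The dual probe below a fake crossing meets another strand (FREE windows)
(line `qkz-strip-boundary-arm` of crux `CardyComplexCone.EdgePrecompact`, stmt-CriticalPhenomena-11387;
the coincidence step of the corrected three-strands dichotomy for MIXED tags at a FREE window —
worker W-HT5 of lead c5, wave 5; companion of `probe_meets_strand_HT5`,
`…UFRSProbeMeetsStrand.lean`, which treats WIRED windows)

At a free window the non-genuine steps of the selected strand (interior RIGHT sector `C`) are
CROSSED edges touching the free row of the inner completion that are open in `ω`. The probe now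
runs through face centres: a chain of dual steps `[faceCenter (cFace q_k), faceCenter (next face)]`
(the crossing segments of corners `q_k` whose target edges lie outside / on the free row of the
inner completion, hence are closed for its completed configuration `β₁`), from a chain face centre
in `C` down into the moat face of the outer completion, where it meets the exterior set. Since `C`
absorbs piece-free preconnected subsets of the annulus meeting it, some piece of some strand meets
one of the crossing segments, and then (`crossSeg_meets_piece_HT4`) that strand passes through the
corner `q_k` or through `nextCorner β₁ q_k` — both have the vertex of `q_k` — at an index of its
stretch (`probe_meets_strand_dual_HT5`, registered anchor `ufrs_probeMeetsStrandDual`).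

References: M. Aizenman, A. Burchard, Duke Math. J. 99 (1999), App. A; S. Smirnov, C. R. Acad.
Sci. Paris 333 (2001), §2.
(buildfix 2026-08-20: comment-only re-land to re-enqueue the module build after its blocking imports were repaired; no declaration changed.)
-/

namespace Summit.CriticalPhenomena.CardyFormulaZ2.Cruxes.EdgePrecompact.QkzStripBoundaryArm

open MeasureTheory Filter Set Metric Complex
open scoped Topology BigOperators Pointwise
open Literature.Probability.LatticeModels Literature.Probability.Percolation
open Literature.Probability.RandomPlanarGeometry (DobrushinDomain)
open Summit.CriticalPhenomena.CardyFormulaZ2.Theses.CardyComplexCone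
open Literature.Topology.PlaneTopology

noncomputable section

/-- A chain of segments with consecutive ones sharing an endpoint is preconnected. -/
theorem isPreconnected_chain_segments_HT5 (A B : ℕ → ℂ) (hlink : ∀ k, B k = A (k + 1)) :
    ∀ n, IsPreconnected (⋃ k ∈ Finset.range n, segment ℝ (A k) (B k)) := by
  intro n
  induction n with
  | zero => simpa using isPreconnected_empty
  | succ n ih =>
    rcases Nat.eq_zero_or_pos n with rfl | hn
    · simpa using (convex_segment (A 0) (B 0)).isPreconnected
    · have hsplit : (⋃ k ∈ Finset.range (n + 1), segment ℝ (A k) (B k)) =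
          (⋃ k ∈ Finset.range n, segment ℝ (A k) (B k)) ∪ segment ℝ (A n) (B n) := by
        rw [Finset.range_add_one, Finset.set_biUnion_insert, Set.union_comm]
      rw [hsplit]
      refine IsPreconnected.union (A n) ?_ (left_mem_segment ℝ _ _) ih (convex_segment _ _).isPreconnected
      refine Set.mem_iUnion₂.2 ⟨n - 1, Finset.mem_range.2 (by omega), ?_⟩
      have h1 : A n = B (n - 1) := by rw [hlink, Nat.sub_add_cancel hn]
      rw [h1]
      exact right_mem_segment ℝ _ _

/-- **The dual probe below a fake crossing meets another strand** (see the module docstring):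
`C` absorbs preconnected piece-free subsets of `U` meeting it; `q 0, …, q (n-1)` are corners whose
crossing segments form a chain inside `U`, whose target edges are `β₁`-closed, the first face
centre in `C` and some point of the chain outside `C`; then some strand passes, at an index of its
stretch, through some `q k` or through `nextCorner β₁ (q k)`. -/
theorem probe_meets_strand_dual_HT5 {k₀ : ℕ} (β : Fin k₀ → BondConfig (Site 2)) (c : Fin k₀ → Site 2 × Fin 4)
    (i j : Fin k₀ → ℕ) (hij : ∀ a, i a ≤ j a) (C U : Set ℂ)
    (habs : ∀ S : Set ℂ, IsPreconnected S → S ⊆ U →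
      (∀ w ∈ S, ∀ a jj, jj ≤ 2 * (j a - i a) →
        w ∉ segment ℝ (pieceVert (β a) (cornerOrbit (β a) (c a) (i a)) jj) (pieceVert (β a) (cornerOrbit (β a) (c a) (i a)) (jj + 1))) →
      (S ∩ C).Nonempty → S ⊆ C)
    (β₁ : BondConfig (Site 2)) (q : ℕ → Site 2 × Fin 4) (n : ℕ) (hq : ∀ k < n, cTgt (q k) ∉ β₁)
    (hlink : ∀ k, faceCenter (faceAt (q k).1 ((q k).2 + 1)) = faceCenter (cFace (q (k + 1))))
    (hU : ∀ k < n, segment ℝ (faceCenter (cFace (q k))) (faceCenter (faceAt (q k).1 ((q k).2 + 1))) ⊆ U)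
    (hstart : faceCenter (cFace (q 0)) ∈ C)
    (P : ℂ) (hP : ∃ k < n, P ∈ segment ℝ (faceCenter (cFace (q k))) (faceCenter (faceAt (q k).1 ((q k).2 + 1)))) (hPC : P ∉ C) :
    ∃ a u k, i a ≤ u ∧ u ≤ j a ∧ k < n ∧
      (cornerOrbit (β a) (c a) u = q k ∨ cornerOrbit (β a) (c a) u = nextCorner β₁ (q k)) := by
  by_contra hne
  push Not at hne
  set S : Set ℂ := ⋃ k ∈ Finset.range n, segment ℝ (faceCenter (cFace (q k))) (faceCenter (faceAt (q k).1 ((q k).2 + 1))) with hS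
  have hmemS : ∀ {w}, w ∈ S ↔ ∃ k < n, w ∈ segment ℝ (faceCenter (cFace (q k))) (faceCenter (faceAt (q k).1 ((q k).2 + 1))) := by
    intro w; simp only [hS, Set.mem_iUnion, Finset.mem_range, exists_prop]
  have hn : 0 < n := by obtain ⟨k, hk, -⟩ := hP; omega
  have hSpre : IsPreconnected S :=
    isPreconnected_chain_segments_HT5 (fun k => faceCenter (cFace (q k))) (fun k => faceCenter (faceAt (q k).1 ((q k).2 + 1)))
      hlink n
  have hSU : S ⊆ U := fun w hw => by obtain ⟨k, hk, hw⟩ := hmemS.1 hw; exact hU k hk hw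
  have hclean : ∀ w ∈ S, ∀ a jj, jj ≤ 2 * (j a - i a) →
      w ∉ segment ℝ (pieceVert (β a) (cornerOrbit (β a) (c a) (i a)) jj) (pieceVert (β a) (cornerOrbit (β a) (c a) (i a)) (jj + 1)) := by
    intro w hw a jj hjj hwp
    obtain ⟨k, hk, hwk⟩ := hmemS.1 hw
    obtain ⟨t, ht, h⟩ := crossSeg_meets_piece_HT4 (hq k hk) (cornerOrbit (β a) (c a) (i a)) hwp hwk
    have ht' : t ≤ j a - i a := by rcases ht with rfl | rfl <;> omega
    rw [← cornerOrbit_add_eq] at h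
    obtain ⟨h1, h2⟩ := hne a (i a + t) k (Nat.le_add_right _ _) (by have := hij a; omega) hk
    rcases h with h | h
    · exact h1 h
    · exact h2 h
  have hsub : S ⊆ C := habs S hSpre hSU hclean ⟨_, hmemS.2 ⟨0, hn, left_mem_segment ℝ _ _⟩, hstart⟩
  obtain ⟨k, hk, hPk⟩ := hP
  exact hPC (hsub (hmemS.2 ⟨k, hk, hPk⟩))

/-- **The dual probe below a fake crossing meets another strand** (registered anchor
`ufrs_probeMeetsStrandDual` of stmt-CriticalPhenomena-11387; `probe_meets_strand_dual_HT5` with all binders explicit). -/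
theorem ufrs_probeMeetsStrandDual : ∀ (k₀ : ℕ) (β : Fin k₀ → BondConfig (Site 2)) (c : Fin k₀ → Site 2 × Fin 4) (i j : Fin k₀ → ℕ), (∀ a, i a ≤ j a) → ∀ (C U : Set ℂ), (∀ S : Set ℂ, IsPreconnected S → S ⊆ U → (∀ w ∈ S, ∀ a jj, jj ≤ 2 * (j a - i a) → w ∉ segment ℝ (pieceVert (β a) (cornerOrbit (β a) (c a) (i a)) jj) (pieceVert (β a) (cornerOrbit (β a) (c a) (i a)) (jj + 1))) → (S ∩ C).Nonempty → S ⊆ C) → ∀ (β₁ : BondConfig (Site 2)) (q : ℕ → Site 2 × Fin 4) (n : ℕ), (∀ k < n, cTgt (q k) ∉ β₁) → (∀ k, faceCenter (faceAt (q k).1 ((q k).2 + 1)) = faceCenter (cFace (q (k + 1)))) → (∀ k < n, segment ℝ (faceCenter (cFace (q k))) (faceCenter (faceAt (q k).1 ((q k).2 + 1))) ⊆ U) → faceCenter (cFace (q 0)) ∈ C → ∀ (P : ℂ), (∃ k < n, P ∈ segment ℝ (faceCenter (cFace (q k))) (faceCenter (faceAt (q k).1 ((q k).2 + 1)))) → P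 ∉ C → ∃ a u k, i a ≤ u ∧ u ≤ j a ∧ k < n ∧ (cornerOrbit (β a) (c a) u = q k ∨ cornerOrbit (β a) (c a) u = nextCorner β₁ (q k)) :=
  fun _k₀ β c i j hij C U habs β₁ q n hq hlink hU hstart P hP hPC =>
    probe_meets_strand_dual_HT5 β c i j hij C U habs β₁ q n hq hlink hU hstart P hP hPC

end

end Summit.CriticalPhenomena.CardyFormulaZ2.Cruxes.EdgePrecompact.QkzStripBoundaryArm
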